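import Literature.MathematicalPhysics.QuantumFieldTheory.Balaban1983to89.B6Ineq2127FaceTorus

/-!
# `Balaban1983to89.B6Ineq2122CentredTorus` — T. Bałaban, *Propagators and renormalization transformations for lattice gauge
# theories. II*, Commun. Math. Phys. **96** (1984) 223–250 [Balaban1984PropagatorsII], p. 244 / p. 246: **the form (2.122)
# `‖B↾_{Λ^c}‖² + L^{−2}‖(Q₁B)↾_{Λ′}‖² + γ₀‖∂₁B‖²` IS BOUNDED FROM BELOW BY `γ₀″‖B‖²` ON THE CONFIGURATIONS (2.121), `γ₀″ = γ₀″(d, L)`** —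
# PROVED ON THE UNIT TORUS OF THE V1 CALCULUS FOR THE CENTRED BLOCK TREES (every `Λ′`, uniformly in the volume), with Lemma 2.4 (2.128)
# for the centred trees as a corollary

statement-level skeleton of published theorems with citation tags; proofs where landed; nothing here is a claim about the Yang–Mills mass gap

PDF held: `paper:balaban1984-cmp96-propagators-rt-ii` (journal page = PDF page + 222; pp. 244–246 [PDF 22–24] read AS IMAGES on the ×4 renders
`run/shared/lean/pub/pub-balaban/b2b-balaban-ref1/pages/1984-cmp96-propagators-rt-II/…-p022…p024-x4.png`, 2026-08-21).

PRINT (verbatim).  p. 244: *"(we take a = 1) ‖B↾_{Λ^c}‖² + L^{−2}‖(Q₁B)↾_{Λ′}‖² + ⟨B, Δ_jB⟩ (2.120) on the configurations B satisfying B(b) = 0 for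
b ⊂ Γ_{y,x}, x ∈ B(y), y ∈ Λ′. (2.121) The form is bounded from above, and bounded from below by ‖B↾_{Λ^c}‖². There is also the bound (2.118),
so let us consider the form ‖B↾_{Λ^c}‖² + L^{−2}‖(Q₁B)↾_{Λ′}‖² + γ₀‖∂₁B‖². (2.122) We will prove that it is bounded from below by γ₀″‖B‖² on the
configurations B satisfying (2.121)."*  p. 245, Lemma 2.4: *"Let a set Λ ⊂ Z^d be a sum of blocks, Λ = B(Λ′). We denote by Λ also a set of bonds b
such that at least one of the end-points b₋, b₊ belongs to Λ. Let B be a configuration defined on Λ and satisfying the condition (2.121):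
B(Γ_{y,x}) = 0 for x ∈ B(y), y ∈ Λ′. We put B = 0 outside Λ. Then the following inequality holds L^{d−2}Σ_{c∈Λ′}|(Q₁B)(c)|² + Σ_p|(∂₁B)(p)|² ≥
(1/(12d²))L^{−d−1}‖B‖². (2.128)"*  p. 246: *"Another consequence is a bound from below for the form (2.120), or for the form (2.122). These
forms are bounded from below by γ₀″‖B‖² with a positive constant γ₀″ dependent on d and L only."*

CITATION HEADER (lean-in-tree rule) — WHAT IS REPRODUCED.  Phase-2 file of the `lit-balaban` typed skeleton (HOME
`run/shared/lean/pub/lit-balaban/`), seat **p22 gen 11** (B6 fold owner r03, referee ref-4; lane = the Sect. C chain (2.95)–(2.147) on the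
concrete two-scale data `tsV1`).  SKELETON rows **B6.Eq2.120 / B6.Txt@246 / B6.Lem2.4** (decls of record r03's `…B6Form2122LowerBound.form2122_lower`
and `…B6Lemma24Printed.lemma24_one`, the ℤ^d CORNER-tree versions with the printed constants, untouched; the V1 calculus fixes the gauge along the
CENTRED staircases `Γ_{emb y,x}` — DIVERGENCE F3 — for which these were not in the tree).  IMPORTS BY NAME the two steps of the same seat:
(2.123) for the centred trees `…B6Ineq2123CentredTorus.inBlk_le_curlBlk`/`sq_le_curlBlk` and the face estimate `…B6Ineq2127FaceTorus.face_sq_le`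
(shape of (2.127)); p31/p08 block-point lemmas.  THIS FILE, on the unit torus `T^{(j)}` (`j + 1 ≤ m + K`), `Λ′ ⊂ T^{(j+1)}` arbitrary:
* §1 bookkeeping: every bond lies inside a block or crosses a face (`inBlock_or_cross`); block sums against torus sums (`sum_bond_coarse`:
  `Σ_b H(⟨y(b₋), μ(b)⟩) = L^d Σ_c H(c)`; `sum_coarse_src`, `sum_coarse_tgt`; `sum_curlBlk`, `sum_outSrc` by fibres);
* §2 **`inBlk_le`**: for `B` in the gauge (2.121) on `Λ′`, EVERY block satisfies `Σ_{b⊂B(y)}|B(b)|² ≤ d³L^{d+2}Σ_{p₋∈B(y)}|(∂₁B)(p)|² +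
  Σ_{b⊂B(y), b∈Λ^c}|B(b)|²` ((2.123) on the blocks of `Λ′`, the `Λ^c`-norm elsewhere); **`sq_le_pointwise`**: every bond value squared is bounded
  by its share of the three terms of (2.122);
* §3 **`ineq2122_fn`** (the p. 244/246 claim): `‖B‖² ≤ Γ(d,L)·(Σ_{b∈Λ^c}|B(b)|² + Σ_{c∈Λ′}|(Q₁B)(c)|² + Σ_p|(∂₁B)(p)|²)`, `Γ = 481d⁶L^{2d+4}`, for
  every `B` satisfying (2.121) on `Λ′`; **`lemma24_centred`**: Lemma 2.4 (2.128) for the centred trees on the torus (shape; constants ours).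
THEOREMS ONLY (no definition, no `def … : Prop` fact); standard axioms.  HONEST SCOPE: CONSTANTS OURS (`Γ = 481d⁶L^{2d+4}` in place of the printed
`12d²L^{d+1}`/`γ₀″`, from the crude block/face bounds of the two imported steps; print: *"γ₀″ dependent on d and L only"* — which is what is proved,
uniformly in the volume, `j` and `Λ′`); the unweighted form (weights `1, L^{−2}, γ₀`, `L^{d−2}` only rescale `Γ`); `‖B↾_{Λ^c}‖²` read as the bonds with
both end blocks outside `Λ′`, `Σ_{c∈Λ′}` as the coarse bonds with an end point in `Λ′` (the Lemma's own convention; the lane's `OutBond`/`InBond`);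
finite tori of the V1 calculus, centred blocks (`L` odd); the sequel `…B6Ineq2122TwoScaleV1` (same seat) draws the consequences for `tsV1`; NOT summit
progress.
-/

noncomputable section

open scoped BigOperators

namespace Literature.MathematicalPhysics.QuantumFieldTheory.Balaban1983to89.B6Ineq2122CentredTorus

open LatticeFieldCalculus B6SectCTwoScaleV1 B6StairStokesTorus B6Ineq2123CentredTorus B6Ineq2127FaceTorus
open BalabanImbrieJaffe1984to88.BIJ85CurlQsstar (shift_blockSite_of_lt shift_blockSite_of_eq)
open BalabanImbrieJaffe1984to88.BIJ85GaugeFunction5113 (exists_blockSite_eq)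

variable {P : Params} {j : ℕ}

/-! ## §1  Bookkeeping: bonds against blocks and faces, block sums against torus sums -/

section Book

/-- **every bond of `T^{(j)}` lies inside a block or crosses a face**: `b = ⟨(y, r), μ⟩` with `r_μ + 1 < L` and `b₊ ∈ B(y)`, or `r_μ = L − 1`
and `b₊ ∈ B(y + e_μ)` (standing range). [cite: Balaban1984PropagatorsII, (2.123)–(2.124) p.244] -/
theorem inBlock_or_cross (hj : j + 1 ≤ P.m + P.K) (b : PBond P j) :
    (∃ r : Fin P.d → Fin P.L, b.src = Site.blockSite (blockOf b.src) r ∧ (r b.dir : ℕ) + 1 < P.L ∧ blockOf b.tgt = blockOf b.src) ∨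
    (∃ r : Fin P.d → Fin P.L, b.src = Site.blockSite (blockOf b.src) r ∧ (r b.dir : ℕ) + 1 = P.L ∧
      blockOf b.tgt = (blockOf b.src).shift b.dir) := by
  obtain ⟨r, hr⟩ := exists_blockSite_eq hj b.src
  have hlt := (r b.dir).isLt
  by_cases h : (r b.dir : ℕ) + 1 < P.L
  · refine Or.inl ⟨r, hr.symm, h, ?_⟩
    rw [PBond.tgt, ← hr, shift_blockSite_of_lt _ r b.dir h, Site.blockOf_blockSite hj, Site.blockOf_blockSite hj]
  · have he : (r b.dir : ℕ) + 1 = P.L := by omega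
    refine Or.inr ⟨r, hr.symm, he, ?_⟩
    rw [PBond.tgt, ← hr, shift_blockSite_of_eq hj _ r b.dir he, Site.blockOf_blockSite hj, Site.blockOf_blockSite hj]

/-- a sum over bonds is a double sum over sites and directions. [folklore] -/
private theorem sum_bond_eq {k : ℕ} {α : Type*} [AddCommMonoid α] (F : PBond P k → α) :
    ∑ b : PBond P k, F b = ∑ x : Site P k, ∑ μ : Fin P.d, F ⟨x, μ⟩ :=
  calc ∑ b : PBond P k, F b = ∑ p : Site P k × Fin P.d, F (bondEquiv p) := (Equiv.sum_comp (bondEquiv (P := P) (j := k)) F).symm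
    _ = ∑ x : Site P k, ∑ μ : Fin P.d, F ⟨x, μ⟩ := Fintype.sum_prod_type _

/-- a sum over the fine torus is the sum over blocks of the sums over block offsets (standing range). [folklore] -/
private theorem sum_blockSite' {α : Type*} [AddCommMonoid α] (hj : j + 1 ≤ P.m + P.K) (F : Site P j → α) :
    ∑ x, F x = ∑ y : Site P (j + 1), ∑ r : Fin P.d → Fin P.L, F (Site.blockSite y r) := by
  rw [← Finset.sum_fiberwise_of_maps_to (s := Finset.univ) (t := Finset.univ) (g := blockOf) (fun _ _ => Finset.mem_univ _) F]
  refine Finset.sum_congr rfl fun y _ => ?_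
  have hmem : ∀ x : Site P j, blockOf x = y ↔ x ∈ ({x ∈ Finset.univ | blockOf x = y} : Finset (Site P j)) := fun x => by simp
  let e : (Fin P.d → Fin P.L) ≃ ↥({x ∈ Finset.univ | blockOf x = y} : Finset (Site P j)) :=
    (Site.blockEquiv hj y).symm.trans (Equiv.subtypeEquivRight hmem)
  rw [← Finset.sum_coe_sort _ F, ← Equiv.sum_comp e (fun a => F a.1)]
  exact Finset.sum_congr rfl fun r _ => rfl

/-- **a block function summed over the fine bonds**: `Σ_{b} H(⟨y(b₋), μ(b)⟩) = L^d Σ_{c∈T^{(j+1)}} H(c)` — each coarse bond `c = ⟨y, y + e_μ⟩` is hit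
by the `L^d` fine bonds of direction `μ` starting in `B(y)`. [cite: Balaban1984PropagatorsI, (1.11) p.19] -/
theorem sum_bond_coarse (hj : j + 1 ≤ P.m + P.K) (H : PBond P (j + 1) → ℝ) :
    ∑ b : PBond P j, H ⟨blockOf b.src, b.dir⟩ = (P.L : ℝ) ^ P.d * ∑ c : PBond P (j + 1), H c := by
  rw [sum_bond_eq, sum_blockSite' hj, sum_bond_eq, Finset.mul_sum]
  refine Finset.sum_congr rfl fun y _ => ?_
  simp only [Site.blockOf_blockSite hj]
  rw [Finset.sum_const, Finset.card_univ, Fintype.card_fun, Fintype.card_fin, Fintype.card_fin, nsmul_eq_mul]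
  push_cast
  ring

/-- `Σ_c G(c₋) = d Σ_y G(y)` on the coarse torus. [folklore] -/
private theorem sum_coarse_src (G : Site P (j + 1) → ℝ) : ∑ c : PBond P (j + 1), G c.src = P.d * ∑ y : Site P (j + 1), G y := by
  rw [sum_bond_eq]
  simp only [Finset.sum_const, Finset.card_univ, Fintype.card_fin, nsmul_eq_mul]
  rw [Finset.mul_sum]

/-- `Σ_c G(c₊) = d Σ_y G(y)` on the coarse torus (each translation is a bijection). [folklore] -/
private theorem sum_coarse_tgt (G : Site P (j + 1) → ℝ) :
    ∑ c : PBond P (j + 1), G ((c.src).shift c.dir) = P.d * ∑ y : Site P (j + 1), G y := by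
  rw [sum_bond_eq, Finset.sum_comm]
  have h : ∀ μ : Fin P.d, ∑ y : Site P (j + 1), G (y.shift μ) = ∑ y : Site P (j + 1), G y := fun μ =>
    Equiv.sum_comp (shiftEquiv (P := P) (j := j + 1) μ) G
  simp only [h, Finset.sum_const, Finset.card_univ, Fintype.card_fin, nsmul_eq_mul]

/-- the block plaquette sums add up to the plaquette sum of the torus. [folklore] -/
private theorem sum_curlBlk (A : VecField P j ℝ) :
    ∑ y : Site P (j + 1), ∑ p ∈ Finset.univ.filter (fun p : Plaq P j => blockOf p.src = y), curl 1 A p ^ 2 = ∑ p : Plaq P j, curl 1 A p ^ 2 :=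
  Finset.sum_fiberwise_of_maps_to (s := Finset.univ) (t := Finset.univ) (g := fun p : Plaq P j => blockOf p.src)
    (fun _ _ => Finset.mem_univ _) _

/-- the block `Λ^c`-sums add up to the `Λ^c`-sum. [folklore] -/
private theorem sum_outSrc (Λ' : Finset (Site P (j + 1))) (A : VecField P j ℝ) :
    ∑ y : Site P (j + 1), ∑ b ∈ (Finset.univ.filter (fun b : PBond P j => blockOf b.src ∉ Λ' ∧ blockOf b.tgt ∉ Λ')).filter
        (fun b => blockOf b.src = y), A b ^ 2 =
      ∑ b ∈ Finset.univ.filter (fun b : PBond P j => blockOf b.src ∉ Λ' ∧ blockOf b.tgt ∉ Λ'), A b ^ 2 :=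
  Finset.sum_fiberwise_of_maps_to (t := Finset.univ) (g := fun b : PBond P j => blockOf b.src) (fun _ _ => Finset.mem_univ _) _

end Book

/-! ## §2  Every block, every bond: the pointwise shares of the three terms of (2.122) -/

section Pointwise

variable (hj : j + 1 ≤ P.m + P.K) (Λ' : Finset (Site P (j + 1))) (A : VecField P j ℝ)
  (hB : ∀ Y ∈ Λ', ∀ r : Fin P.d → Fin P.L, stairSum A (emb Y) (Site.blockSite Y r) = 0)

include hj hB in
/-- **every block**: `Σ_{b⊂B(y)}|B(b)|² ≤ d³L^{d+2}Σ_{p₋∈B(y)}|(∂₁B)(p)|² + Σ_{b⊂B(y), b∈Λ^c}|B(b)|²` — (2.123) for the blocks of `Λ′` (gauge (2.121)),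
and for the other blocks every bond inside is a `Λ^c`-bond. [cite: Balaban1984PropagatorsII, (2.123) p.244] -/
theorem inBlk_le (y : Site P (j + 1)) :
    ∑ b ∈ Finset.univ.filter (fun b : PBond P j => blockOf b.src = y ∧ blockOf b.tgt = y), A b ^ 2 ≤
      (P.d : ℝ) ^ 3 * (P.L : ℝ) ^ (P.d + 2) * ∑ p ∈ Finset.univ.filter (fun p : Plaq P j => blockOf p.src = y), curl 1 A p ^ 2 +
      ∑ b ∈ (Finset.univ.filter (fun b : PBond P j => blockOf b.src ∉ Λ' ∧ blockOf b.tgt ∉ Λ')).filter (fun b => blockOf b.src = y),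
        A b ^ 2 := by
  have h1 : 0 ≤ (P.d : ℝ) ^ 3 * (P.L : ℝ) ^ (P.d + 2) * ∑ p ∈ Finset.univ.filter (fun p : Plaq P j => blockOf p.src = y), curl 1 A p ^ 2 :=
    mul_nonneg (by positivity) (Finset.sum_nonneg fun _ _ => sq_nonneg _)
  have h2 : 0 ≤ ∑ b ∈ (Finset.univ.filter (fun b : PBond P j => blockOf b.src ∉ Λ' ∧ blockOf b.tgt ∉ Λ')).filter
      (fun b => blockOf b.src = y), A b ^ 2 := Finset.sum_nonneg fun _ _ => sq_nonneg _
  by_cases hy : y ∈ Λ'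
  · exact (inBlk_le_curlBlk hj A y (hB y hy)).trans (le_add_of_nonneg_right h2)
  · refine le_trans ?_ (le_add_of_nonneg_left h1)
    apply Finset.sum_le_sum_of_subset_of_nonneg
    · intro b hb
      rw [Finset.mem_filter] at hb
      rw [Finset.mem_filter, Finset.mem_filter]
      refine ⟨⟨Finset.mem_univ _, ?_, ?_⟩, hb.2.1⟩
      · rw [hb.2.1]; exact hy
      · rw [hb.2.2]; exact hy
    · exact fun _ _ _ => sq_nonneg _

include hj hB in
/-- **every bond**: `|B(b)|²` is at most its `Λ^c`-share, plus `d²L²` times the plaquettes of its block (a bond inside a block of `Λ′`, (2.123)),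
plus — for a bond crossing the face `c = ⟨y(b₋), y(b₋) + e_μ⟩` — `120d²L²` times (`|(Q₁B)(c)|²` if `c ∈ Λ′`) + `(1 + d³L^{d+2})`(plaquettes of the two
blocks) + (`Λ^c`-bonds inside the two blocks) (the face estimate, then (2.123) or the `Λ^c`-norm inside each block).
[cite: Balaban1984PropagatorsII, (2.127) p.245] -/
theorem sq_le_pointwise (b : PBond P j) :
    A b ^ 2 ≤ (if blockOf b.src ∉ Λ' ∧ blockOf b.tgt ∉ Λ' then A b ^ 2 else 0) +
      (P.d : ℝ) ^ 2 * (P.L : ℝ) ^ 2 * ∑ p ∈ Finset.univ.filter (fun p : Plaq P j => blockOf p.src = blockOf b.src), curl 1 A p ^ 2 +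
      120 * (P.d : ℝ) ^ 2 * (P.L : ℝ) ^ 2 *
        ((if (blockOf b.src ∈ Λ' ∨ (blockOf b.src).shift b.dir ∈ Λ') then bondAvg A ⟨blockOf b.src, b.dir⟩ ^ 2 else 0) +
         (1 + (P.d : ℝ) ^ 3 * (P.L : ℝ) ^ (P.d + 2)) *
           (∑ p ∈ Finset.univ.filter (fun p : Plaq P j => blockOf p.src = blockOf b.src), curl 1 A p ^ 2 +
            ∑ p ∈ Finset.univ.filter (fun p : Plaq P j => blockOf p.src = (blockOf b.src).shift b.dir), curl 1 A p ^ 2) +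
         (∑ b' ∈ (Finset.univ.filter (fun b' : PBond P j => blockOf b'.src ∉ Λ' ∧ blockOf b'.tgt ∉ Λ')).filter
              (fun b' => blockOf b'.src = blockOf b.src), A b' ^ 2 +
          ∑ b' ∈ (Finset.univ.filter (fun b' : PBond P j => blockOf b'.src ∉ Λ' ∧ blockOf b'.tgt ∉ Λ')).filter
              (fun b' => blockOf b'.src = (blockOf b.src).shift b.dir), A b' ^ 2)) := by
  classical
  -- abbreviations
  set y := blockOf b.src with hy
  set μ := b.dir with hμ
  set Cu : Site P (j + 1) → ℝ := fun z => ∑ p ∈ Finset.univ.filter (fun p : Plaq P j => blockOf p.src = z), curl 1 A p ^ 2 with hCu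
  set Os : Site P (j + 1) → ℝ := fun z => ∑ b' ∈ (Finset.univ.filter (fun b' : PBond P j => blockOf b'.src ∉ Λ' ∧ blockOf b'.tgt ∉ Λ')).filter
    (fun b' => blockOf b'.src = z), A b' ^ 2 with hOs
  set Ib : Site P (j + 1) → ℝ := fun z => ∑ b' ∈ Finset.univ.filter (fun b' : PBond P j => blockOf b'.src = z ∧ blockOf b'.tgt = z), A b' ^ 2
    with hIb
  have hCu0 : ∀ z, 0 ≤ Cu z := fun z => Finset.sum_nonneg fun _ _ => sq_nonneg _
  have hOs0 : ∀ z, 0 ≤ Os z := fun z => Finset.sum_nonneg fun _ _ => sq_nonneg _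
  have hK0 : 0 ≤ 1 + (P.d : ℝ) ^ 3 * (P.L : ℝ) ^ (P.d + 2) := by positivity
  have hIb_le : ∀ z, Ib z ≤ (P.d : ℝ) ^ 3 * (P.L : ℝ) ^ (P.d + 2) * Cu z + Os z := fun z => inBlk_le hj Λ' A hB z
  -- the three shares are nonnegative
  have hT1 : 0 ≤ (if blockOf b.src ∉ Λ' ∧ blockOf b.tgt ∉ Λ' then A b ^ 2 else 0) := by split_ifs <;> positivity
  have hT2 : 0 ≤ (P.d : ℝ) ^ 2 * (P.L : ℝ) ^ 2 * Cu y := by positivity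
  have hT3 : 0 ≤ 120 * (P.d : ℝ) ^ 2 * (P.L : ℝ) ^ 2 *
      ((if (y ∈ Λ' ∨ y.shift μ ∈ Λ') then bondAvg A ⟨y, μ⟩ ^ 2 else 0) + (1 + (P.d : ℝ) ^ 3 * (P.L : ℝ) ^ (P.d + 2)) * (Cu y + Cu (y.shift μ))
        + (Os y + Os (y.shift μ))) := by
    have : 0 ≤ (if (y ∈ Λ' ∨ y.shift μ ∈ Λ') then bondAvg A ⟨y, μ⟩ ^ 2 else 0) := by split_ifs <;> positivity
    positivity
  show A b ^ 2 ≤ (if blockOf b.src ∉ Λ' ∧ blockOf b.tgt ∉ Λ' then A b ^ 2 else 0) + (P.d : ℝ) ^ 2 * (P.L : ℝ) ^ 2 * Cu y +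
      120 * (P.d : ℝ) ^ 2 * (P.L : ℝ) ^ 2 *
        ((if (y ∈ Λ' ∨ y.shift μ ∈ Λ') then bondAvg A ⟨y, μ⟩ ^ 2 else 0) +
          (1 + (P.d : ℝ) ^ 3 * (P.L : ℝ) ^ (P.d + 2)) * (Cu y + Cu (y.shift μ)) + (Os y + Os (y.shift μ)))
  have hb_eq : b = ⟨b.src, μ⟩ := rfl
  rcases inBlock_or_cross hj b with ⟨r, hr, hrμ, htgt⟩ | ⟨r, hr, hrμ, htgt⟩
  · -- a bond inside the block `B(y)`
    by_cases hyΛ : y ∈ Λ'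
    · -- (2.123) for the centred trees
      have h := sq_le_curlBlk hj A y (hB y hyΛ) r μ hrμ
      rw [← hr] at h
      calc A b ^ 2 = A ⟨b.src, μ⟩ ^ 2 := by rw [← hb_eq]
        _ ≤ (P.d : ℝ) ^ 2 * (P.L : ℝ) ^ 2 * Cu y := h
        _ ≤ _ := by linarith
    · -- a `Λ^c`-bond
      have hout : blockOf b.src ∉ Λ' ∧ blockOf b.tgt ∉ Λ' := ⟨hyΛ, by rw [htgt]; exact hyΛ⟩
      rw [if_pos hout]
      linarith
  · -- a bond crossing the face `c = ⟨y, y + e_μ⟩`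
    by_cases hIn : y ∈ Λ' ∨ y.shift μ ∈ Λ'
    · rw [if_pos hIn]
      have h := face_sq_le hj A y μ r hrμ
      rw [← hr] at h
      have hI1 := hIb_le y
      have hI2 := hIb_le (y.shift μ)
      have hc0 : 0 ≤ 120 * (P.d : ℝ) ^ 2 * (P.L : ℝ) ^ 2 := by positivity
      calc A b ^ 2 = A ⟨b.src, μ⟩ ^ 2 := by rw [← hb_eq]
        _ ≤ 120 * (P.d : ℝ) ^ 2 * (P.L : ℝ) ^ 2 * (bondAvg A ⟨y, μ⟩ ^ 2 + Cu y + Ib y + Ib (y.shift μ)) := h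
        _ ≤ 120 * (P.d : ℝ) ^ 2 * (P.L : ℝ) ^ 2 * (bondAvg A ⟨y, μ⟩ ^ 2 + Cu y +
              ((P.d : ℝ) ^ 3 * (P.L : ℝ) ^ (P.d + 2) * Cu y + Os y) + ((P.d : ℝ) ^ 3 * (P.L : ℝ) ^ (P.d + 2) * Cu (y.shift μ) + Os (y.shift μ))) := by
            gcongr
        _ ≤ _ := by
            have h3 : 0 ≤ Cu (y.shift μ) := hCu0 _
            nlinarith [hCu0 y, hOs0 y, hOs0 (y.shift μ)]
    · -- both blocks outside `Λ′`: a `Λ^c`-bond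
      have hout : blockOf b.src ∉ Λ' ∧ blockOf b.tgt ∉ Λ' :=
        ⟨fun h => hIn (Or.inl h), by rw [htgt]; exact fun h => hIn (Or.inr h)⟩
      rw [if_pos hout]
      linarith

end Pointwise

/-! ## §3  The printed claim: (2.122) is bounded from below by `γ₀″‖B‖²` on (2.121), `γ₀″ = γ₀″(d, L)` -/

section Claim

variable (hj : j + 1 ≤ P.m + P.K) (Λ' : Finset (Site P (j + 1)))

include hj in
/-- **p. 244 / p. 246 claim, function form** (centred trees of the V1 calculus, constants ours): for every `B` on the unit torus in the gauge
(2.121) on `Λ′`, `‖B‖² ≤ 481d⁶L^{2d+4}·(Σ_{b∈Λ^c}|B(b)|² + Σ_{c∈Λ′}|(Q₁B)(c)|² + Σ_p|(∂₁B)(p)|²)`.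
[cite: Balaban1984PropagatorsII, (2.122) p.244] -/
theorem ineq2122_fn (A : VecField P j ℝ) (hB : ∀ Y ∈ Λ', ∀ r : Fin P.d → Fin P.L, stairSum A (emb Y) (Site.blockSite Y r) = 0) :
    ∑ b : PBond P j, A b ^ 2 ≤ 481 * (P.d : ℝ) ^ 6 * (P.L : ℝ) ^ (2 * P.d + 4) *
      (∑ b ∈ Finset.univ.filter (fun b : PBond P j => blockOf b.src ∉ Λ' ∧ blockOf b.tgt ∉ Λ'), A b ^ 2 +
        ∑ c ∈ Finset.univ.filter (fun c : PBond P (j + 1) => c.src ∈ Λ' ∨ c.tgt ∈ Λ'), bondAvg A c ^ 2 +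
        ∑ p : Plaq P j, curl 1 A p ^ 2) := by
  classical
  set Cu : Site P (j + 1) → ℝ := fun z => ∑ p ∈ Finset.univ.filter (fun p : Plaq P j => blockOf p.src = z), curl 1 A p ^ 2 with hCu
  set Os : Site P (j + 1) → ℝ := fun z => ∑ b' ∈ (Finset.univ.filter (fun b' : PBond P j => blockOf b'.src ∉ Λ' ∧ blockOf b'.tgt ∉ Λ')).filter
    (fun b' => blockOf b'.src = z), A b' ^ 2 with hOs
  set Out := ∑ b ∈ Finset.univ.filter (fun b : PBond P j => blockOf b.src ∉ Λ' ∧ blockOf b.tgt ∉ Λ'), A b ^ 2 with hOut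
  set Qs := ∑ c ∈ Finset.univ.filter (fun c : PBond P (j + 1) => c.src ∈ Λ' ∨ c.tgt ∈ Λ'), bondAvg A c ^ 2 with hQs
  set Cr := ∑ p : Plaq P j, curl 1 A p ^ 2 with hCr
  set K := (P.d : ℝ) ^ 3 * (P.L : ℝ) ^ (P.d + 2) with hK
  have hd1 : (1 : ℝ) ≤ P.d := by exact_mod_cast P.hd
  have hL1 : (1 : ℝ) ≤ P.L := by exact_mod_cast P.L_pos
  have hK1 : 1 ≤ K := by
    have h1 : (1 : ℝ) ≤ (P.d : ℝ) ^ 3 := one_le_pow₀ hd1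
    have h2 : (1 : ℝ) ≤ (P.L : ℝ) ^ (P.d + 2) := one_le_pow₀ hL1
    nlinarith
  have hOut0 : 0 ≤ Out := Finset.sum_nonneg fun _ _ => sq_nonneg _
  have hQs0 : 0 ≤ Qs := Finset.sum_nonneg fun _ _ => sq_nonneg _
  have hCr0 : 0 ≤ Cr := Finset.sum_nonneg fun _ _ => sq_nonneg _
  -- sum the pointwise bound over all bonds
  have hpt : ∀ b : PBond P j, A b ^ 2 ≤ (if blockOf b.src ∉ Λ' ∧ blockOf b.tgt ∉ Λ' then A b ^ 2 else 0) +
      (P.d : ℝ) ^ 2 * (P.L : ℝ) ^ 2 * Cu (blockOf b.src) +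
      120 * (P.d : ℝ) ^ 2 * (P.L : ℝ) ^ 2 *
        ((if (blockOf b.src ∈ Λ' ∨ (blockOf b.src).shift b.dir ∈ Λ') then bondAvg A ⟨blockOf b.src, b.dir⟩ ^ 2 else 0) +
          (1 + K) * (Cu (blockOf b.src) + Cu ((blockOf b.src).shift b.dir)) + (Os (blockOf b.src) + Os ((blockOf b.src).shift b.dir))) :=
    fun b => sq_le_pointwise hj Λ' A hB b
  have hsum := Finset.sum_le_sum fun b (_ : b ∈ (Finset.univ : Finset (PBond P j))) => hpt b
  -- evaluate the sums of the shares
  have e1 : ∑ b : PBond P j, (if blockOf b.src ∉ Λ' ∧ blockOf b.tgt ∉ Λ' then A b ^ 2 else 0) = Out := by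
    rw [hOut, Finset.sum_filter]
  have e2 : ∑ b : PBond P j, Cu (blockOf b.src) = P.d * (P.L : ℝ) ^ P.d * Cr := by
    have h := sum_bond_coarse hj (fun c => Cu c.src)
    simp only at h
    rw [h, sum_coarse_src, hCr, ← sum_curlBlk A]
    ring
  have e3 : ∑ b : PBond P j, Cu ((blockOf b.src).shift b.dir) = P.d * (P.L : ℝ) ^ P.d * Cr := by
    have h := sum_bond_coarse hj (fun c => Cu (c.src.shift c.dir))
    simp only at h
    rw [h, sum_coarse_tgt, hCr, ← sum_curlBlk A]
    ring
  have e4 : ∑ b : PBond P j, Os (blockOf b.src) = P.d * (P.L : ℝ) ^ P.d * Out := by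
    have h := sum_bond_coarse hj (fun c => Os c.src)
    simp only at h
    rw [h, sum_coarse_src, hOut, ← sum_outSrc Λ' A]
    ring
  have e5 : ∑ b : PBond P j, Os ((blockOf b.src).shift b.dir) = P.d * (P.L : ℝ) ^ P.d * Out := by
    have h := sum_bond_coarse hj (fun c => Os (c.src.shift c.dir))
    simp only at h
    rw [h, sum_coarse_tgt, hOut, ← sum_outSrc Λ' A]
    ring
  have e6 : ∑ b : PBond P j, (if (blockOf b.src ∈ Λ' ∨ (blockOf b.src).shift b.dir ∈ Λ') then bondAvg A ⟨blockOf b.src, b.dir⟩ ^ 2 else 0)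
      = (P.L : ℝ) ^ P.d * Qs := by
    have h := sum_bond_coarse hj (fun c => if (c.src ∈ Λ' ∨ c.src.shift c.dir ∈ Λ') then bondAvg A c ^ 2 else 0)
    simp only at h
    rw [h, hQs, Finset.sum_filter]
    rfl
  -- put everything together
  have htot : ∑ b : PBond P j, A b ^ 2 ≤ Out + (P.d : ℝ) ^ 2 * (P.L : ℝ) ^ 2 * (P.d * (P.L : ℝ) ^ P.d * Cr) +
      120 * (P.d : ℝ) ^ 2 * (P.L : ℝ) ^ 2 * ((P.L : ℝ) ^ P.d * Qs + (1 + K) * (P.d * (P.L : ℝ) ^ P.d * Cr + P.d * (P.L : ℝ) ^ P.d * Cr)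
        + (P.d * (P.L : ℝ) ^ P.d * Out + P.d * (P.L : ℝ) ^ P.d * Out)) := by
    refine hsum.trans (le_of_eq ?_)
    simp only [Finset.sum_add_distrib, ← Finset.mul_sum, e1, e2, e3, e4, e5, e6]
  -- compare the coefficients with `Γ = 481 d⁶ L^{2d+4} = 481 K²`
  have hΓ : 481 * (P.d : ℝ) ^ 6 * (P.L : ℝ) ^ (2 * P.d + 4) = 481 * K ^ 2 := by
    rw [hK]; ring
  have hc2 : (P.d : ℝ) ^ 2 * (P.L : ℝ) ^ 2 * (P.d * (P.L : ℝ) ^ P.d) = K := by rw [hK]; ring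
  have hc3 : (P.d : ℝ) ^ 2 * (P.L : ℝ) ^ 2 * (P.L : ℝ) ^ P.d ≤ K := by
    rw [hK]
    have : (P.d : ℝ) ^ 2 * (P.L : ℝ) ^ 2 * (P.L : ℝ) ^ P.d = (P.d : ℝ) ^ 2 * (P.L : ℝ) ^ (P.d + 2) := by ring
    rw [this]
    have h3 : (P.d : ℝ) ^ 2 ≤ (P.d : ℝ) ^ 3 := pow_le_pow_right₀ hd1 (by norm_num)
    exact mul_le_mul_of_nonneg_right h3 (by positivity)
  rw [hΓ]
  calc ∑ b : PBond P j, A b ^ 2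
      ≤ Out + (P.d : ℝ) ^ 2 * (P.L : ℝ) ^ 2 * (P.d * (P.L : ℝ) ^ P.d * Cr) +
        120 * (P.d : ℝ) ^ 2 * (P.L : ℝ) ^ 2 * ((P.L : ℝ) ^ P.d * Qs + (1 + K) * (P.d * (P.L : ℝ) ^ P.d * Cr + P.d * (P.L : ℝ) ^ P.d * Cr)
          + (P.d * (P.L : ℝ) ^ P.d * Out + P.d * (P.L : ℝ) ^ P.d * Out)) := htot
    _ = (1 + 240 * K) * Out + 120 * ((P.d : ℝ) ^ 2 * (P.L : ℝ) ^ 2 * (P.L : ℝ) ^ P.d) * Qs + (K + 240 * K * (1 + K)) * Cr := by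
        rw [← hc2]; ring
    _ ≤ (1 + 240 * K) * Out + 120 * K * Qs + (K + 240 * K * (1 + K)) * Cr := by
        have := mul_le_mul_of_nonneg_right (mul_le_mul_of_nonneg_left hc3 (by norm_num : (0 : ℝ) ≤ 120)) hQs0
        linarith
    _ ≤ 481 * K ^ 2 * Out + 481 * K ^ 2 * Qs + 481 * K ^ 2 * Cr := by
        have h1 : (1 + 240 * K) * Out ≤ 481 * K ^ 2 * Out := mul_le_mul_of_nonneg_right (by nlinarith) hOut0
        have h2 : 120 * K * Qs ≤ 481 * K ^ 2 * Qs := mul_le_mul_of_nonneg_right (by nlinarith) hQs0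
        have h3 : (K + 240 * K * (1 + K)) * Cr ≤ 481 * K ^ 2 * Cr := mul_le_mul_of_nonneg_right (by nlinarith) hCr0
        linarith
    _ = 481 * K ^ 2 * (Out + Qs + Cr) := by ring

include hj in
/-- **Lemma 2.4 (2.128) for the centred trees of the V1 torus calculus** (shape of the printed Lemma, constants ours): for `B` in the gauge
(2.121) on `Λ′` and *"B = 0 outside Λ"*, `Λ = B(Λ′)` (i.e. `B(b) = 0` unless an end point of `b` lies in a block of `Λ′`),
`‖B‖² ≤ 481d⁶L^{2d+4}·(Σ_{c∈Λ′}|(Q₁B)(c)|² + Σ_p|(∂₁B)(p)|²)` (printed: `L^{d−2}Σ_{c∈Λ′}|(Q₁B)(c)|² + Σ_p|(∂₁B)(p)|² ≥ (1/(12d²))L^{−d−1}‖B‖²`;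
decl of record r03's `…B6Lemma24Printed.lemma24_one`, ℤ^d, corner trees, printed constant). [cite: Balaban1984PropagatorsII, Lemma 2.4 p.245] -/
theorem lemma24_centred (A : VecField P j ℝ) (hB : ∀ Y ∈ Λ', ∀ r : Fin P.d → Fin P.L, stairSum A (emb Y) (Site.blockSite Y r) = 0)
    (hout : ∀ b : PBond P j, blockOf b.src ∉ Λ' → blockOf b.tgt ∉ Λ' → A b = 0) :
    ∑ b : PBond P j, A b ^ 2 ≤ 481 * (P.d : ℝ) ^ 6 * (P.L : ℝ) ^ (2 * P.d + 4) *
      (∑ c ∈ Finset.univ.filter (fun c : PBond P (j + 1) => c.src ∈ Λ' ∨ c.tgt ∈ Λ'), bondAvg A c ^ 2 +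
        ∑ p : Plaq P j, curl 1 A p ^ 2) := by
  have h := ineq2122_fn hj Λ' A hB
  have h0 : ∑ b ∈ Finset.univ.filter (fun b : PBond P j => blockOf b.src ∉ Λ' ∧ blockOf b.tgt ∉ Λ'), A b ^ 2 = 0 := by
    refine Finset.sum_eq_zero fun b hb => ?_
    obtain ⟨h1, h2⟩ := (Finset.mem_filter.1 hb).2
    rw [hout b h1 h2]
    ring
  rw [h0, zero_add] at h
  exact h

end Claim

end Literature.MathematicalPhysics.QuantumFieldTheory.Balaban1983to89.B6Ineq2122CentredTorus

end
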